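import Mathlib.MeasureTheory.Function.JacobianOneDim
import Mathlib.Analysis.SpecialFunctions.Pow.Real
import Mathlib.Analysis.SpecialFunctions.Log.Basic
import Mathlib.Analysis.SpecialFunctions.Trigonometric.Deriv
import Literature.NumberTheory.ConnesConsani2021.ArchimedeanSoninTrace
import HarnessLib

/-!
# Connes–Consani 2021 — the archimedean functional `W_∞` AS PRINTED, and its transport to the tree (PROVED)

A. Connes, C. Consani, *Weil positivity and trace formula, the archimedean place*, Selecta Math.
(N.S.) 27 (2021) 77 (= arXiv:2006.13771) [bib: `ConnesConsani2021`].  The statement layer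
`ArchimedeanSoninTrace.lean` binds CC's `W_∞` to the tree BY NAME (`archW := weilArchTermBombieri`, a
definitional transport "checked by hand symbol by symbol" — the cell referee's audit row B2).  This
file (cell `pub-rhdoor`, seat cc-2) removes the hand check: it types `W_∞` LITERALLY as printed, in
the multiplicative variable —

* `mulSharp f x := x⁻¹ f(x⁻¹)` ("with `f♯(x) := x⁻¹ f(x⁻¹)`", App. B p. 31);
* `bombieriWR f := (log 4π + γ) f(1) + ∫₁^∞ (f(x) + f♯(x) − (2/x) f(1)) dx/(x − x⁻¹)` (App. B eq. (83)
  p. 31: "The archimedean distribution is defined as 𝒲_ℝ(f) := …", citing [EB] = Bombieri 2000);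
* `deltaInvHalf F x := x^{-1/2} F(x)` and `ccWInfty F := −𝒲_ℝ(Δ^{-1/2} F)` (Intro p. 3 l. 16:
  "`W_v(f) := 𝒲_v(Δ^{-1/2} f)`", with "`𝒲_∞ = −𝒲_ℝ`", App. B p. 31; `Δ^{1/2} f(x) = x^{1/2} f(x)`);
* `mulLift g := g ∘ log`, CC's test function on `ℝ₊*` attached to the tree's additive avatar `g`

— and PROVES `ccWInfty_mulLift : ccWInfty (mulLift g) = archW g` (`= weilArchTermBombieri g`) by the
substitution `x = e^t` (`dx/(x − x⁻¹) = e^t dt/(2 sinh t)`, `(e^t)^{-1/2} g(t) e^t = e^{t/2} g(t)`,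
`f♯(e^t) e^t = e^{t/2} g(−t)`, `(2/x) f(1) e^t = 2 g(0)`), i.e. Mathlib's one-dimensional change of
variables `integral_image_eq_integral_abs_deriv_smul` for `exp : (0,∞) → (1,∞)`.  No named fact.
-/

noncomputable section

open _root_.MeasureTheory Complex Set
open scoped Real

namespace Literature.NumberTheory.ConnesConsani2021

open Literature.NumberTheory.LFunctions

/-- `f♯(x) := x⁻¹ f(x⁻¹)` (App. B p. 31). [cite: ConnesConsani2021, App. B p. 31] -/
def mulSharp (f : ℝ → ℂ) (x : ℝ) : ℂ :=
  ((x⁻¹ : ℝ) : ℂ) * f x⁻¹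

/-- The integrand `(f(x) + f♯(x) − (2/x) f(1)) / (x − x⁻¹)` of Bombieri's archimedean distribution
(App. B eq. (83) p. 31). [cite: ConnesConsani2021, App. B eq. (83) p. 31] -/
def bombieriWRIntegrand (f : ℝ → ℂ) (x : ℝ) : ℂ :=
  (f x + mulSharp f x - ((2 / x : ℝ) : ℂ) * f 1) / ((x - x⁻¹ : ℝ) : ℂ)

/-- **Bombieri's archimedean distribution, as printed** (App. B eq. (83) p. 31, multiplicative
variable): `𝒲_ℝ(f) := (log 4π + γ) f(1) + ∫₁^∞ (f(x) + f♯(x) − (2/x) f(1)) dx/(x − x⁻¹)`.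
[cite: ConnesConsani2021, App. B eq. (83) p. 31] -/
def bombieriWR (f : ℝ → ℂ) : ℂ :=
  (Real.log (4 * π) + Real.eulerMascheroniConstant : ℂ) * f 1 +
    ∫ x in Ioi (1 : ℝ), bombieriWRIntegrand f x

/-- `Δ^{-1/2} F (x) := x^{-1/2} F(x)` (Intro p. 3: `Δ^{1/2} f(x) = x^{1/2} f(x)`).
[cite: ConnesConsani2021, Intro p. 3] -/
def deltaInvHalf (F : ℝ → ℂ) (x : ℝ) : ℂ :=
  ((x ^ (-(1 / 2 : ℝ)) : ℝ) : ℂ) * F x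

/-- **CC's archimedean functional, as printed**: `W_∞(F) := 𝒲_∞(Δ^{-1/2} F) = −𝒲_ℝ(Δ^{-1/2} F)`
(Intro p. 3 l. 16 "`W_v(f) := 𝒲_v(Δ^{-1/2} f)`"; App. B p. 31 "`𝒲_∞ = −𝒲_ℝ`").
[cite: ConnesConsani2021, Intro p. 3; App. B p. 31] -/
def ccWInfty (F : ℝ → ℂ) : ℂ :=
  -bombieriWR (deltaInvHalf F)

/-- CC's test function on `ℝ₊*` attached to the additive avatar `g`: `F = g ∘ log` (the dictionary of
`ArchimedeanSoninTrace.lean`). [cite: ConnesConsani2021, App. A p. 30] -/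
def mulLift (g : ℝ → ℂ) (x : ℝ) : ℂ :=
  g (Real.log x)

/-- `Δ^{-1/2}(g ∘ log)(1) = g(0)`. [folklore] -/
private theorem deltaInvHalf_mulLift_one (g : ℝ → ℂ) : deltaInvHalf (mulLift g) 1 = g 0 := by
  simp [deltaInvHalf, mulLift]

/-- `exp` maps `(0, ∞)` onto `(1, ∞)`. [folklore] -/
private theorem image_exp_Ioi_zero : Real.exp '' Ioi (0 : ℝ) = Ioi 1 := by
  ext x
  constructor
  · rintro ⟨t, ht, rfl⟩
    exact Real.one_lt_exp_iff.mpr ht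
  · intro hx
    have hx0 : 0 < x := lt_trans one_pos hx
    exact ⟨Real.log x, Real.log_pos hx, Real.exp_log hx0⟩

/-- The substitution `x = e^t` in the integrand of (83) for `f = Δ^{-1/2}(g ∘ log)`:
`e^t · (f(e^t) + f♯(e^t) − 2e^{-t} f(1))/(e^t − e^{-t}) = (e^{t/2}(g(t) + g(−t)) − 2 g(0))/(2 sinh t)`.
[folklore] -/
private theorem integrand_exp (g : ℝ → ℂ) {t : ℝ} (ht : 0 < t) :
    |Real.exp t| • bombieriWRIntegrand (deltaInvHalf (mulLift g)) (Real.exp t) =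
      ((Real.exp (t / 2) : ℂ) * (g t + g (-t)) - 2 * g 0) / (2 * Real.sinh t : ℂ) := by
  set a : ℝ := Real.exp (t / 2) with ha
  have ha0 : 0 < a := Real.exp_pos _
  have hexp : Real.exp t = a * a := by rw [ha, ← Real.exp_add]; ring_nf
  have hexp_neg : Real.exp (-t) = (a * a)⁻¹ := by rw [Real.exp_neg, hexp]
  have hpow : (Real.exp t) ^ (-(1 / 2 : ℝ)) = a⁻¹ := by
    rw [← Real.exp_mul, ha, ← Real.exp_neg]; ring_nf
  have hpow' : (Real.exp (-t)) ^ (-(1 / 2 : ℝ)) = a := by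
    rw [← Real.exp_mul, ha]; ring_nf
  have hsinhA : Real.sinh t = (a * a - (a * a)⁻¹) / 2 := by
    rw [Real.sinh_eq, hexp_neg, hexp]
  have habs : |Real.exp t| = a * a := by rw [abs_of_pos (Real.exp_pos t), hexp]
  have ha1 : 1 < a := by rw [ha]; exact Real.one_lt_exp_iff.mpr (by linarith)
  simp only [bombieriWRIntegrand, mulSharp, deltaInvHalf, mulLift, Real.log_exp, Real.log_one,
    Real.one_rpow, hpow, ← Real.exp_neg, hpow', habs, Complex.real_smul, hsinhA]
  rw [hexp_neg, hexp]
  have ha0' : (a : ℂ) ≠ 0 := by exact_mod_cast ha0.ne'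
  have ha4 : (a : ℂ) * a * (a * a) - 1 ≠ 0 := by
    have h2 : (1 : ℝ) < a * a := by nlinarith
    have h : (1 : ℝ) < a * a * (a * a) := by nlinarith
    have h' : (a * a * (a * a) - 1 : ℝ) ≠ 0 := by linarith
    exact_mod_cast h'
  push_cast
  field_simp

/-- **The dictionary, PROVED**: CC's `W_∞`, typed as printed (Intro p. 3 + App. B (83)), evaluated on
`g ∘ log`, IS the tree's `weilArchTermBombieri g` (hence `archW g`) — the substitution `x = e^t`.
This upgrades the definitional transport `archW := weilArchTermBombieri` of the statement layer to a
theorem. [cite: ConnesConsani2021, Intro p. 3; App. B eq. (83) p. 31] -/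
theorem ccWInfty_mulLift (g : ℝ → ℂ) : ccWInfty (mulLift g) = archW g := by
  unfold ccWInfty bombieriWR archW weilArchTermBombieri
  have hcv := integral_image_eq_integral_abs_deriv_smul (s := Ioi (0 : ℝ)) (f := Real.exp)
    (f' := Real.exp) measurableSet_Ioi (fun x _ => (Real.hasDerivAt_exp x).hasDerivWithinAt)
    Real.exp_injective.injOn (bombieriWRIntegrand (deltaInvHalf (mulLift g)))
  rw [image_exp_Ioi_zero] at hcv
  rw [hcv, deltaInvHalf_mulLift_one, setIntegral_congr_fun measurableSet_Ioi (fun t ht => integrand_exp g ht)]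

/-- Hence CC's Theorem 1 / eq. (4) read with the PRINTED `W_∞` (App. B) is the typed statement: for
every `g`, `W_∞(g∘log ∗ (g∘log)*)` in CC's sense equals `archW (g ⋆ g*)`, because
`(g ⋆ g*) ∘ log = (g∘log) ∗ (g∘log)*` is again of the form `mulLift` — stated here for an arbitrary
additive avatar `k` in place of `g ⋆ g*`. [cite: ConnesConsani2021, Intro p. 3; App. B eq. (83) p. 31] -/
theorem archW_eq_ccWInfty (k : ℝ → ℂ) : archW k = ccWInfty (mulLift k) :=
  (ccWInfty_mulLift k).symm

end Literature.NumberTheory.ConnesConsani2021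

end
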